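import Literature.NumberTheory.Rogawski1990.ArchTorusOrbitalOneSidedLimitsProof   -- ★ p849361 (LH3-p04 (g2)): the N = 3 twin `archTorusOrbitalOneSidedLimits_holds`; its GENERIC §1 `Literature.Analysis.Calculus.exists_tendsto_nhdsGT_of_tendsto_deriv` ∕ `…nhdsLT…` is IMPORTED here (not copied); brings the letter file `ArchLimitFormula` and the `archLocal` ∕ `circleDiagonal` currency
import Literature.NumberTheory.Automorphic.ArchRankOneLimitFormulaGroup            -- ★ (R1G) p840661 ED. 2 (B-p17): `UnitaryGroup.exists_tendsto_deriv_two_sin_smul_orbitalIntegral` — Harish-Chandra's limit formula ON THE GROUP `U(e₀,e₁)`, `e₀e₁ < 0`, with differentiability on `0 < |ψ| < 1`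
import Literature.Analysis.Calculus.ContDiffCompactSupportCutoff                   -- ★ p840156: `exists_contDiff_hasCompactSupport_comp_eq` (ambient compact support WLOG)
import HarnessLib

/-!
# (C-bdry) FOR `N = 2`: Harish-Chandra's one-sided limits of the normalised torus orbital integral and of its `ψ`-derivative at the (central) wall of the compact
# Cartan of `G_w = U(σ_w diag β)(ℂ) ≅ U(1,1)` (Varadarajan 1989 §6.4 Thms 18, 20; Rogawski 1990 §8.2 p. 119) — the named twin of ★ `ArchTorusOrbitalOneSidedLimits` with `3 ↦ 2`, PROVED

Topic `NumberTheory/Rogawski1990`; namespace `Literature.NumberTheory.Rogawski1990`.  ONE named fact `def ArchTorusOrbitalOneSidedLimitsTwo L β w : Prop` (the verbatim `3 ↦ 2`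
twin of the floor-2 letter (C-bdry) ★ `ArchTorusOrbitalOneSidedLimits L α w` of `ArchLimitFormula.lean`) and its discharge `theorem archTorusOrbitalOneSidedLimitsTwo_holds`; no instance, no
notation, no axiom, no `sorry`.  Cell `pub/hodgecm-mathlib`, line LH3 (closer stub `stub_N9` — archimedean endoscopic transfer — of `Cruxes/H413/Lines/F0_U3LettersRung1.lean`, crux H413 =
`stmt-HodgeConjecture-24833`): organ (J0-H2) of the DIRECT ROAD to `stub_N9` (LH3-plan (g2) `MEMO-N9-direct-road.v1` ∕ `D2-SPEC-ArchBouazizSpaceH.v1` §3: the (I₃) «order ≤ 1» jump clause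
on `H_∞`, organ (J0-H), reads the `U(1,1)_w` block of `H_w = U(2) × U(1)` through this fact), dealt 2026-09-02 (DEALER WORDS #4 (g2)) to LH7-p02 (g2).

THE STATEMENT (token for token the N = 3 letter with `3 ↦ 2`).  In `G_w = U(σ_w diag β)(ℂ)` (`archLocal L 2 (diagonal β) w`, any Haar measure `ν`), for a smooth `Θ` on `M₂(ℂ)` whose
restriction to `G_w` has compact support, and a point `z₀` of the wall `{z 0 = z 1}` of the circle torus — for `N = 2` the wall IS the centre `{z • 1}` of `G_w` — whose eigenvalue pair
spans an INDEFINITE plane (`re σ_w(β₀) · re σ_w(β₁) < 0`, i.e. `G_w ≅ U(1,1)`, the noncompact guard of the N = 3 letter): along the one-angle curve `ψ ↦ diag(z₀₀ e^{iψ}, z₀₁ e^{−iψ})` the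
normalised torus orbital integral `g(ψ) = 2 sin ψ · ∫_{G_w} Θ(g diag(z_ψ) g⁻¹) dν(g)` and its `ψ`-derivative have one-sided limits `Jp, Jm, Dp, Dm` at `ψ = 0` (print: Varadarajan's `F_{f,B}` on
`SL(2,ℝ) ≅ SU(1,1)`, Thm 18 «all `θ`-derivatives bounded on `B′`», Thm 20 «the one-sided limits exist»; Rogawski's `g(ψ)` of §8.2 p. 119 read on the `2 × 2` block).  The frame guards
`β_i ≠ 0`, `(σ_w β_i).im = 0` sit INSIDE the Prop exactly as in the N = 3 letter (true AS NAMED).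

THE PROOF (shorter than the N = 3 twin ★ `archTorusOrbitalOneSidedLimits_holds`, and WITHOUT the CM hypothesis that one inherits from the descent (J-nc)₃): for `N = 2` there is nothing
to descend — the wall point is central — and Harish-Chandra's limit formula ON THE GROUP `U(e₀,e₁)` is already the tree's ★ (R1G) `UnitaryGroup.exists_tendsto_deriv_two_sin_smul_orbitalIntegral`
(any commutative ring `L`, any `σ : L →+* ℂ`; `archLocal L 2 (diagonal β) w` IS `unitaryGroupOfForm conj ((diagonal β).map σ_w)` by definition): ONE `C ≠ 0` with
`∂_ψ[2 sin ψ · ∫ f(h diag(z e^{iψ}, z e^{−iψ}) h⁻¹) dν] → C • f(z • 1)` as `ψ → 0`, `ψ ≠ 0`, and differentiability for `0 < |ψ| < 1`, for every `f ∈ C¹_c(M₂(ℂ))`.  So: (i) replace `Θ`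
by a `Θ′ ∈ C^∞_c(M₂(ℂ))` agreeing with it on `G_w` (★ `exists_contDiff_hasCompactSupport_comp_eq` — both sides only read `Θ ∘ ↑↑`); (ii) identify the letter's curve
`(z₀ i · e^{i(1,−1)_i ψ})_i` with (R1G)'s `(z₀₀ e^{iψ}, z₀₀ e^{−iψ})` (`z₀ 0 = z₀ 1`) and the scalar `(2 sin ψ : ℂ) · _` with `(2 sin ψ) • _`; (iii) (R1G) gives the two-sided punctured
limit `D = C • Θ′(z₀₀ • 1)` of `g′` and differentiability at all small `ψ ≠ 0`, whence `Dp = Dm = D`; (iv) the generic §1 of ★ `ArchTorusOrbitalOneSidedLimitsProof` (a function differentiable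
near `0⁺` ∕ `0⁻` with convergent derivative there has a one-sided limit there: mean value inequality ⇒ Lipschitz ⇒ Cauchy) gives `Jp`, `Jm`.

WHAT IS PROVED.
* `ArchTorusOrbitalOneSidedLimitsTwo L β w` (`def … : Prop`, the named twin) and **`archTorusOrbitalOneSidedLimitsTwo_holds : ArchTorusOrbitalOneSidedLimitsTwo L β w`** for EVERY field `L`,
  `β : Fin 2 → L`, complex place `w` (no number-field ∕ CM hypothesis).
NOT HERE (deliberately): the (J-nc)₂ twin «`g′(ψ) → c · F^A`» as a NAMED fact — for `N = 2` it is ★ (R1G) itself up to the identification (ii) (value `C • Θ(z₀₀ • 1)`, ONE `C ≠ 0` per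
`ν`); the dealer decides whether (J0-H) consumes (R1G) by name or wants a letter text.  HONEST LABEL: HC_CM is proved only modulo the 7 printed citations (2 remaining: hLiu418 =
stmt-HodgeConjecture-24832, h413 = stmt-HodgeConjecture-24833) until rung 0 closes; this file is count-neutral for the closer (an in-house organ of the LH3 direct road, not a closer row).

## References
* [Varadarajan1989] V. S. Varadarajan, *An Introduction to Harmonic Analysis on Semisimple Lie Groups*, Cambridge Stud. Adv. Math. 16 (1989), §6.4 Thm 18, Thm 20, Thm 22 (the
  `SL(2,ℝ)` limit formulae) — held e-text chunks p0207–p0210.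
* [Rogawski1990] J. D. Rogawski, *Automorphic Representations of Unitary Groups in Three Variables*, Ann. of Math. Stud. 123 (1990), §8.2 Prop. 8.2.1 pp. 118–119 (`g(ψ) = 2 sin ψ · Φ_H`,
  Harish-Chandra's limit formula via [A₁] Lemma 7.1), §3.8 p. 30.
-/

set_option autoImplicit false

noncomputable section

open MeasureTheory Measure Filter Topology NumberField NumberField.InfinitePlace Set
open Literature.MeasureTheory.Group Literature.NumberTheory.Automorphic Literature.NumberTheory.Automorphic.UnitaryGroup Literature.Analysis.Calculus
open scoped Matrix MatrixGroups Matrix.Norms.Operator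

namespace Literature.NumberTheory.Rogawski1990

section Letter

variable (L : Type) [Field L] (β : Fin 2 → L) (w : {w : InfinitePlace L // IsComplex w})

/-- **(C-bdry) FOR `N = 2` — HARISH-CHANDRA'S ONE-SIDED LIMITS AT THE (CENTRAL, NONCOMPACT) WALL OF THE COMPACT CARTAN OF `U(1,1)_w`** [Varadarajan1989 §6.4 Thm 18 (all
`θ`-derivatives of `F_{f,B}` bounded on `B′`), Thm 20 (the one-sided limits `J_{r,±}` exist) — the `SL(2,ℝ) ≅ SU(1,1)` model; cited by Rogawski1990 §8.2 p. 119 through [A₁] = Arthur1974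
L. 7.1], the verbatim twin of ★ `ArchTorusOrbitalOneSidedLimits L α w` with `3 ↦ 2`.  In `G_w = U(σ_w diag β)(ℂ)` (`archLocal L 2 (diagonal β) w`, any Haar measure `ν`), for a smooth `Θ`
(restricted from `M_2(ℂ)`, compactly supported on `G_w`) and a point `z₀` of the wall `{z 0 = z 1}` of the circle torus (the centre of `G_w`) whose eigenvalue pair spans an INDEFINITE plane
(`re σ_w(β₀) · re σ_w(β₁) < 0`: `G_w ≅ U(1,1)`): along the one-angle curve `ψ ↦ diag(z₀₀ e^{iψ}, z₀₁ e^{−iψ})` the normalised torus orbital integral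
`g(ψ) = 2 sin ψ · ∫_{G_w} Θ(g diag(z_ψ) g⁻¹) dν(g)` (print's `g(ψ)` on the `2 × 2` block) has one-sided limits at `ψ = 0`, and so has its `ψ`-derivative (which exists for `0 < |ψ| < 1` by ★ (R1G)).
The frame guards `β_i ≠ 0`, `(σ_w β_i).im = 0` sit INSIDE the Prop (true AS NAMED), as in the N = 3 letter.  PROVED below (`archTorusOrbitalOneSidedLimitsTwo_holds`, every field `L`).
Consumer: the (I₃) «order ≤ 1» clause on `H_∞` of the LH3 direct road to `stub_N9` (organ (J0-H)). [cite: Varadarajan1989, §6.4 Thm 18, Thm 20] [cite: Rogawski1990, §8.2 p. 119] -/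
def ArchTorusOrbitalOneSidedLimitsTwo : Prop :=
  ∀ [MeasurableSpace (archLocal L 2 (Matrix.diagonal β) w)] [BorelSpace (archLocal L 2 (Matrix.diagonal β) w)],
    (∀ i, β i ≠ 0) → (∀ i, (w.1.embedding (β i)).im = 0) →
    ∀ (ν : Measure (archLocal L 2 (Matrix.diagonal β) w)) [ν.IsHaarMeasure]
    (Θ : Matrix (Fin 2) (Fin 2) ℂ → ℂ), ContDiff ℝ (⊤ : ℕ∞) Θ →
    HasCompactSupport (fun k : archLocal L 2 (Matrix.diagonal β) w => Θ ((k : GL (Fin 2) ℂ) : Matrix (Fin 2) (Fin 2) ℂ)) →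
    ∀ (z₀ : Fin 2 → Circle), z₀ 0 = z₀ 1 → (w.1.embedding (β 0)).re * (w.1.embedding (β 1)).re < 0 →
    ∃ Jp Jm Dp Dm : ℂ,
      Tendsto (fun ψ : ℝ => (2 * Real.sin ψ : ℂ) *
          ∫ g, Θ (((g * ⟨circleDiagonal 2 (fun i => z₀ i * Circle.exp (![(1 : ℝ), -1] i * ψ)),
            circleDiagonal_mem_archLocal_diagonal L 2 β w _⟩ * g⁻¹ : archLocal L 2 (Matrix.diagonal β) w) : GL (Fin 2) ℂ) : Matrix (Fin 2) (Fin 2) ℂ) ∂ν)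
        (𝓝[>] 0) (𝓝 Jp) ∧
      Tendsto (fun ψ : ℝ => (2 * Real.sin ψ : ℂ) *
          ∫ g, Θ (((g * ⟨circleDiagonal 2 (fun i => z₀ i * Circle.exp (![(1 : ℝ), -1] i * ψ)),
            circleDiagonal_mem_archLocal_diagonal L 2 β w _⟩ * g⁻¹ : archLocal L 2 (Matrix.diagonal β) w) : GL (Fin 2) ℂ) : Matrix (Fin 2) (Fin 2) ℂ) ∂ν)
        (𝓝[<] 0) (𝓝 Jm) ∧
      Tendsto (fun ψ : ℝ => deriv (fun ψ : ℝ => (2 * Real.sin ψ : ℂ) *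
          ∫ g, Θ (((g * ⟨circleDiagonal 2 (fun i => z₀ i * Circle.exp (![(1 : ℝ), -1] i * ψ)),
            circleDiagonal_mem_archLocal_diagonal L 2 β w _⟩ * g⁻¹ : archLocal L 2 (Matrix.diagonal β) w) : GL (Fin 2) ℂ) : Matrix (Fin 2) (Fin 2) ℂ) ∂ν) ψ)
        (𝓝[>] 0) (𝓝 Dp) ∧
      Tendsto (fun ψ : ℝ => deriv (fun ψ : ℝ => (2 * Real.sin ψ : ℂ) *
          ∫ g, Θ (((g * ⟨circleDiagonal 2 (fun i => z₀ i * Circle.exp (![(1 : ℝ), -1] i * ψ)),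
            circleDiagonal_mem_archLocal_diagonal L 2 β w _⟩ * g⁻¹ : archLocal L 2 (Matrix.diagonal β) w) : GL (Fin 2) ℂ) : Matrix (Fin 2) (Fin 2) ℂ) ∂ν) ψ)
        (𝓝[<] 0) (𝓝 Dm)

end Letter

section Proof

variable (L : Type) [Field L] (β : Fin 2 → L) (w : {w : InfinitePlace L // IsComplex w})

/-- **THE `N = 2` LETTER (C-bdry) HOLDS**, for every field `L`: at a point `z₀` of the (central) wall of the circle torus of `G_w = U(σ_w diag β)(ℂ) ≅ U(1,1)`, the normalised torus orbital
integral `g(ψ) = 2 sin ψ · ∫_{G_w} Θ(g·diag(z_ψ)·g⁻¹) dν` and its `ψ`-derivative have one-sided limits at `ψ = 0` (and the two derivative limits coincide, `= C • Θ(z₀₀ • 1)`).  Proof: module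
docstring — ambient compact support WLOG (★ `exists_contDiff_hasCompactSupport_comp_eq`), Harish-Chandra's limit formula on the group ★ (R1G) `exists_tendsto_deriv_two_sin_smul_orbitalIntegral`
at `f := Θ′`, `z := z₀ 0`, then the generic one-sided-limit lemmas of ★ `ArchTorusOrbitalOneSidedLimitsProof` §1.
[cite: Varadarajan1989, §6.4 Thm 18, Thm 20, Thm 22] [cite: Rogawski1990, §8.2 p. 119] -/
theorem archTorusOrbitalOneSidedLimitsTwo_holds : ArchTorusOrbitalOneSidedLimitsTwo L β w := by
  intro instM instB _hβ hreal ν instH Θ hΘ hΘc z₀ h01 hnc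
  classical
  -- (i) WLOG `Θ` has AMBIENT compact support: both sides only read `Θ ∘ ↑↑`
  have hcoe : Continuous fun k : archLocal L 2 (Matrix.diagonal β) w => ((k : GL (Fin 2) ℂ) : Matrix (Fin 2) (Fin 2) ℂ) :=
    Units.continuous_val.comp continuous_subtype_val
  obtain ⟨Θ', hΘ', hΘ'c, -, hagree⟩ := exists_contDiff_hasCompactSupport_comp_eq
    (ι := fun k : archLocal L 2 (Matrix.diagonal β) w => ((k : GL (Fin 2) ℂ) : Matrix (Fin 2) (Fin 2) ℂ)) hcoe hΘ hΘc
  have hΘ'1 : ContDiff ℝ 1 Θ' := hΘ'.of_le (by exact_mod_cast le_top)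
  -- (iii) Harish-Chandra's limit formula ON THE GROUP `G_w = U(σ_w β₀, σ_w β₁)` (★ (R1G); `archLocal` is `unitaryGroupOfForm conj ((diagonal β).map σ_w)` by definition)
  obtain ⟨C, -, hR⟩ := @exists_tendsto_deriv_two_sin_smul_orbitalIntegral ℂ _ _ _ L _ w.1.embedding β hreal hnc instM instB ν instH
  obtain ⟨hD, hdiff⟩ := hR Θ' hΘ'1 hΘ'c (z₀ 0)
  -- (ii) the letter's function IS (R1G)'s function at `f := Θ′`, `z := z₀ 0`
  have hpt : ∀ ψ : ℝ, (⟨circleDiagonal 2 (fun i => z₀ i * Circle.exp (![(1 : ℝ), -1] i * ψ)),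
        circleDiagonal_mem_archLocal_diagonal L 2 β w _⟩ : archLocal L 2 (Matrix.diagonal β) w) =
      ⟨circleDiagonal 2 ![z₀ 0 * Circle.exp ψ, z₀ 0 * Circle.exp (-ψ)], circleDiagonal_mem_archLocal_diagonal L 2 β w _⟩ := fun ψ => by
    apply Subtype.ext
    change circleDiagonal 2 (fun i => z₀ i * Circle.exp (![(1 : ℝ), -1] i * ψ)) = circleDiagonal 2 ![z₀ 0 * Circle.exp ψ, z₀ 0 * Circle.exp (-ψ)]
    congr 1
    funext i
    fin_cases i
    · simp
    · simp [h01]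
  have key : (fun ψ : ℝ => (2 * Real.sin ψ : ℂ) *
        ∫ g, Θ (((g * ⟨circleDiagonal 2 (fun i => z₀ i * Circle.exp (![(1 : ℝ), -1] i * ψ)),
          circleDiagonal_mem_archLocal_diagonal L 2 β w _⟩ * g⁻¹ : archLocal L 2 (Matrix.diagonal β) w) : GL (Fin 2) ℂ) : Matrix (Fin 2) (Fin 2) ℂ) ∂ν) =
      fun ψ : ℝ => (2 * Real.sin ψ) •
        ∫ g, Θ' (((g * ⟨circleDiagonal 2 ![z₀ 0 * Circle.exp ψ, z₀ 0 * Circle.exp (-ψ)],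
          circleDiagonal_mem_archLocal_diagonal L 2 β w _⟩ * g⁻¹ : archLocal L 2 (Matrix.diagonal β) w) : GL (Fin 2) ℂ) : Matrix (Fin 2) (Fin 2) ℂ) ∂ν := by
    funext ψ
    have h2 : ((2 * Real.sin ψ : ℝ) : ℂ) = 2 * (Real.sin ψ : ℂ) := by norm_cast
    rw [Complex.real_smul, hpt ψ, h2]
    congr 1
    exact integral_congr_ae (Eventually.of_forall fun g => (hagree _).symm)
  rw [key]
  -- differentiability at all small `ψ ≠ 0`
  have hev : ∀ᶠ ψ in 𝓝[≠] (0 : ℝ), DifferentiableAt ℝ (fun ψ : ℝ => (2 * Real.sin ψ) •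
      ∫ g, Θ' (((g * ⟨circleDiagonal 2 ![z₀ 0 * Circle.exp ψ, z₀ 0 * Circle.exp (-ψ)],
        circleDiagonal_mem_archLocal_diagonal L 2 β w _⟩ * g⁻¹ : archLocal L 2 (Matrix.diagonal β) w) : GL (Fin 2) ℂ) : Matrix (Fin 2) (Fin 2) ℂ) ∂ν) ψ := by
    have h1 : Ioo (-1 : ℝ) 1 ∈ 𝓝 (0 : ℝ) := Ioo_mem_nhds (by norm_num) (by norm_num)
    filter_upwards [mem_nhdsWithin_of_mem_nhds h1, self_mem_nhdsWithin] with ψ hψ hψ0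
    exact hdiff ψ hψ hψ0
  have hD' : Tendsto (fun ψ : ℝ => deriv (fun ψ : ℝ => (2 * Real.sin ψ) •
      ∫ g, Θ' (((g * ⟨circleDiagonal 2 ![z₀ 0 * Circle.exp ψ, z₀ 0 * Circle.exp (-ψ)],
        circleDiagonal_mem_archLocal_diagonal L 2 β w _⟩ * g⁻¹ : archLocal L 2 (Matrix.diagonal β) w) : GL (Fin 2) ℂ) : Matrix (Fin 2) (Fin 2) ℂ) ∂ν) ψ)
      (𝓝[≠] 0) (𝓝 (C • Θ' (((z₀ 0 : Circle) : ℂ) • (1 : Matrix (Fin 2) (Fin 2) ℂ)))) := hD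
  -- (iv) restrict to the two sides and integrate the derivative bound (★ §1 of `ArchTorusOrbitalOneSidedLimitsProof`)
  have hGT : (𝓝[>] (0 : ℝ)) ≤ 𝓝[≠] 0 := nhdsWithin_mono _ fun x hx => ne_of_gt hx
  have hLT : (𝓝[<] (0 : ℝ)) ≤ 𝓝[≠] 0 := nhdsWithin_mono _ fun x hx => ne_of_lt hx
  obtain ⟨Jp, hJp⟩ := exists_tendsto_nhdsGT_of_tendsto_deriv (hev.filter_mono hGT) (hD'.mono_left hGT)
  obtain ⟨Jm, hJm⟩ := exists_tendsto_nhdsLT_of_tendsto_deriv (hev.filter_mono hLT) (hD'.mono_left hLT)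
  exact ⟨Jp, Jm, _, _, hJp, hJm, hD'.mono_left hGT, hD'.mono_left hLT⟩

end Proof

end Literature.NumberTheory.Rogawski1990

end
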